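import Summits.BirchSwinnertonDyer.Rank1Residual.Additive.RationalLineOfKernelPolynomialMembers
import Summits.BirchSwinnertonDyer.Rank1Residual.Partition.EisensteinKernelRealPoints
import Literature.NumberTheory.LFunctions.RationalExpSumNewton
import HarnessLib

/-!
# The Greenberg–Vatsal PARITY of the rational `p`-line of a kernel polynomial `h`, read off the
# coefficients of `h`: the TRACE CERTIFICATE `T(h) = 4p₃ + b₂p₂ + 2b₄p₁ + m·b₆ > 0 ⇒ even`
# (cell `bsd-addord`, seat `bsd-addord-twist`; File B of the Φ₀ kernel-records programme at `p ≥ 5`)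

HONEST FRAMING (cell `bsd-addord`, `run/shared/lean/pub/bsd-addord/README.md` §4): the programme's
target of record is the full Birch–Swinnerton-Dyer formula for every `E/ℚ` of analytic rank `≤ 1`;
this is a TOOL file (elementary: Newton sums + the tree's real-points reading of parity; theorems only,
no definition, no named fact, no `sorry`). It books nothing.

## What

Let `Φ ≤ E[p]` (`p` odd) be the rational `p`-line of a kernel-polynomial certificate
(`RationalLineOfKernelPolynomial{,Members}.lean`): `W.preΨ' p = h · q`, `h ∈ ℚ[X]` MONIC of degree
`m = (p − 1)/2`, and every non-zero point of `Φ` has abscissa a root of `h` (hence, by the converse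
`KernelPolyLine.exists_mem_abscissa_of_eval_eq_zero`, EVERY root of `h` in `ℚ̄` carries a non-zero
point of `Φ`). The tree reads the parity of `Φ` at ONE point: `LineOdd W p Φ ↔ Re ι(Ψ₂Sq(x)) < 0`,
`Ψ₂Sq = 4X³ + b₂X² + 2b₄X + b₆`, the value being REAL (`KernelDisc.re_neg_of_lineOdd`,
`re_pos_of_lineEven`, `Partition/EisensteinKernelRealPoints.lean`). Summing over all `m` roots
`α₁, …, α_m` of `h` (with multiplicity) gives a RATIONAL number, computable from the top three
coefficients of `h` by Newton's identities:
`Σ_i Ψ₂Sq(α_i) = 4p₃ + b₂p₂ + 2b₄p₁ + m·b₆ =: T(h)`, `p₁ = e₁`, `p₂ = e₁² − 2e₂`,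
`p₃ = e₁³ − 3e₁e₂ + 3e₃`, `e_k = (−1)^k · coeff_{m−k}(h)` (`e₃ = 0` when `m = 2`).
Hence the certificate theorems
* **`lineEven_of_traceCert_pos`**: `T(h) > 0 ⇒ LineEven W p Φ` (if `Φ` were odd every summand
  would be a negative real);
* **`lineOdd_of_traceCert_neg`**: `T(h) < 0 ⇒ LineOdd W p Φ`.
(`T(h) = 0` cannot occur.) The per-row use (Files `X3LineDatum*Records*`): `E₁, E₂, E₃ ∈ ℚ` read off
`h`, one `norm_num` inequality — replacing the engines' Sturm-sequence sign computation
(`HOME/proof/phi0-p5/README.md`, column `signs_F_at_roots`) by a kernel-checked rational identity.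

Contents: §1 power sums `p₁, p₂, p₃` of a multiset from its elementary symmetric functions
(induction; the recursion `e_{j+1}(a ∷ s) = e_{j+1}(s) + a·e_j(s)` is the tree's `RationalExpSum.esymm_cons_succ`); §2 Vieta for the roots of the
monic `h` in `ℚ̄` (Mathlib `coeff_eq_esymm_roots_of_card`, `IsAlgClosed.card_roots_eq_natDegree`);
§3 the trace identity `Σ_roots Ψ₂Sq = T(h)`; §4 the certificates.

References: J. H. Silverman, *AEC* 2nd ed., III.2.3, Exercise 3.7 [SilvermanAEC2009]; R. Greenberg,
V. Vatsal, Invent. Math. 142 (2000) Thm. 1.3 ("even") [GreenbergVatsal2000]; I. G. Macdonald,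
*Symmetric functions and Hall polynomials* (1995) I (2.11′) (Newton's identities) [folklore];
HOME/proof/phi0-p5/README.md (engine dictionary: parity = sign of `F` at the real roots of `h`).
-/

set_option autoImplicit false

noncomputable section

open scoped Classical ComplexConjugate

open WeierstrassCurve Polynomial Literature.NumberTheory.EllipticCurves
  Literature.NumberTheory.EllipticCurves.Rank1Residual Literature.NumberTheory.GaloisRepresentations
  Field

namespace Summit.BirchSwinnertonDyer.Rank1Residual.Additive.KernelPolyLine

/-! ## §1 Power sums of a multiset from its elementary symmetric functions (Newton, `k ≤ 3`) -/

section PowerSums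

variable {L : Type*} [CommRing L]

/-- `e₀(s) = 1`. [folklore] -/
theorem esymm_zero_eq_one (s : Multiset L) : s.esymm 0 = 1 := by
  simp [Multiset.esymm, Multiset.powersetCard_zero_left]

/-- `e₁(a ∷ s) = e₁(s) + a`. [folklore] -/
theorem esymm_cons_one (a : L) (s : Multiset L) : (a ::ₘ s).esymm 1 = s.esymm 1 + a := by
  rw [show (1 : ℕ) = 0 + 1 from rfl, Literature.NumberTheory.LFunctions.RationalExpSum.esymm_cons_succ, esymm_zero_eq_one, mul_one]

/-- `e₂(a ∷ s) = e₂(s) + a · e₁(s)`. [folklore] -/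
theorem esymm_cons_two (a : L) (s : Multiset L) : (a ::ₘ s).esymm 2 = s.esymm 2 + a * s.esymm 1 := by
  rw [show (2 : ℕ) = 1 + 1 from rfl, Literature.NumberTheory.LFunctions.RationalExpSum.esymm_cons_succ]

/-- `e₃(a ∷ s) = e₃(s) + a · e₂(s)`. [folklore] -/
theorem esymm_cons_three (a : L) (s : Multiset L) : (a ::ₘ s).esymm 3 = s.esymm 3 + a * s.esymm 2 := by
  rw [show (3 : ℕ) = 2 + 1 from rfl, Literature.NumberTheory.LFunctions.RationalExpSum.esymm_cons_succ]

/-- `e_k(s) = 0` for `k > #s`. [folklore] -/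
theorem esymm_eq_zero_of_card_lt (s : Multiset L) {k : ℕ} (hk : Multiset.card s < k) : s.esymm k = 0 := by
  simp [Multiset.esymm, Multiset.powersetCard_eq_empty k hk]

/-- The empty multiset has `e₁ = e₂ = e₃ = 0`. [folklore] -/
theorem esymm_zero_one_two_three :
    (0 : Multiset L).esymm 1 = 0 ∧ (0 : Multiset L).esymm 2 = 0 ∧ (0 : Multiset L).esymm 3 = 0 :=
  ⟨esymm_eq_zero_of_card_lt 0 (by simp), esymm_eq_zero_of_card_lt 0 (by simp),
    esymm_eq_zero_of_card_lt 0 (by simp)⟩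

/-- **Newton, `k = 1`**: `p₁ = e₁`. [folklore] -/
theorem sum_map_pow_one_eq (s : Multiset L) : (s.map (fun x ↦ x)).sum = s.esymm 1 := by
  induction s using Multiset.induction_on with
  | empty => rw [Multiset.map_zero, Multiset.sum_zero, esymm_zero_one_two_three.1]
  | cons a t ih => rw [Multiset.map_cons, Multiset.sum_cons, ih, esymm_cons_one]; ring

/-- **Newton, `k = 2`**: `p₂ = e₁² − 2e₂`. [folklore] -/
theorem sum_map_pow_two_eq (s : Multiset L) :
    (s.map (fun x ↦ x ^ 2)).sum = s.esymm 1 ^ 2 - 2 * s.esymm 2 := by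
  induction s using Multiset.induction_on with
  | empty =>
    rw [Multiset.map_zero, Multiset.sum_zero, esymm_zero_one_two_three.1, esymm_zero_one_two_three.2.1]
    ring
  | cons a t ih => rw [Multiset.map_cons, Multiset.sum_cons, ih, esymm_cons_one, esymm_cons_two]; ring

/-- **Newton, `k = 3`**: `p₃ = e₁³ − 3e₁e₂ + 3e₃`. [folklore] -/
theorem sum_map_pow_three_eq (s : Multiset L) :
    (s.map (fun x ↦ x ^ 3)).sum = s.esymm 1 ^ 3 - 3 * s.esymm 1 * s.esymm 2 + 3 * s.esymm 3 := by
  induction s using Multiset.induction_on with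
  | empty =>
    rw [Multiset.map_zero, Multiset.sum_zero, esymm_zero_one_two_three.1, esymm_zero_one_two_three.2.1,
      esymm_zero_one_two_three.2.2]
    ring
  | cons a t ih =>
    rw [Multiset.map_cons, Multiset.sum_cons, ih, esymm_cons_one, esymm_cons_two, esymm_cons_three]
    ring

/-- Summing a cubic over a multiset. [folklore] -/
theorem sum_map_cubic_eq (s : Multiset L) (a b c d : L) :
    (s.map (fun x ↦ a * x ^ 3 + b * x ^ 2 + c * x + d)).sum =
      a * (s.map (fun x ↦ x ^ 3)).sum + b * (s.map (fun x ↦ x ^ 2)).sum +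
        c * (s.map (fun x ↦ x)).sum + (Multiset.card s : L) * d := by
  induction s using Multiset.induction_on with
  | empty => simp
  | cons x t ih =>
    simp only [Multiset.map_cons, Multiset.sum_cons, Multiset.card_cons, ih]
    push_cast
    ring

end PowerSums

/-! ## §2 Vieta for the roots of the monic `h` in `ℚ̄` -/

/-- **Vieta**: for `h ∈ ℚ[X]` monic of degree `m` with roots `α₁, …, α_m ∈ ℚ̄` (with multiplicity),
`e_k(α) = (−1)^k · coeff_{m−k}(h)` for `k ≤ m`; and there are exactly `m` roots. [folklore] -/
theorem roots_esymm_eq_coeff {h : ℚ[X]} (hmon : h.Monic) {m : ℕ} (hdegm : h.natDegree = m) {k : ℕ}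
    (hk : k ≤ m) :
    Multiset.card (h.map (algebraMap ℚ (AlgebraicClosure ℚ))).roots = m ∧
      ((h.map (algebraMap ℚ (AlgebraicClosure ℚ))).roots).esymm k =
        (-1) ^ k * algebraMap ℚ (AlgebraicClosure ℚ) (h.coeff (m - k)) := by
  set g := h.map (algebraMap ℚ (AlgebraicClosure ℚ)) with hg
  have hgmon : g.Monic := hmon.map _
  have hgdeg : g.natDegree = m := by rw [hg, hmon.natDegree_map, hdegm]
  have hroots : Multiset.card g.roots = g.natDegree := IsAlgClosed.card_roots_eq_natDegree
  refine ⟨by rw [hroots, hgdeg], ?_⟩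
  have hv := coeff_eq_esymm_roots_of_card hroots (k := m - k) (by rw [hgdeg]; omega)
  rw [hgmon.leadingCoeff, one_mul, hgdeg, show m - (m - k) = k by omega, hg, coeff_map] at hv
  rw [hv, ← mul_assoc, ← pow_add, ← two_mul, pow_mul, neg_one_sq, one_pow, one_mul]

/-! ## §3 The trace identity `Σ_{h(α)=0} Ψ₂Sq(α) = T(h)` -/

/-- `Ψ₂Sq(α) = 4α³ + b₂α² + 2b₄α + b₆` in `ℚ̄`. [folklore] -/
theorem aeval_Ψ₂Sq_eq (W : WeierstrassCurve ℚ) (α : AlgebraicClosure ℚ) :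
    aeval α W.Ψ₂Sq = 4 * α ^ 3 + algebraMap ℚ (AlgebraicClosure ℚ) W.b₂ * α ^ 2 +
      (2 * algebraMap ℚ (AlgebraicClosure ℚ) W.b₄) * α + algebraMap ℚ (AlgebraicClosure ℚ) W.b₆ := by
  simp only [Ψ₂Sq, map_add, map_mul, aeval_C, aeval_X, map_pow, map_ofNat]

/-- **The trace identity.** For `h ∈ ℚ[X]` monic of degree `m ≥ 2` with `coeff_{m−1} = −E₁`,
`coeff_{m−2} = E₂`, and `coeff_{m−3} = −E₃` if `m ≥ 3` (`E₃ = 0` if `m = 2`), the sum of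
`Ψ₂Sq = 4X³ + b₂X² + 2b₄X + b₆` over the roots of `h` in `ℚ̄` is the rational number
`T = 4(E₁³ − 3E₁E₂ + 3E₃) + b₂(E₁² − 2E₂) + 2b₄E₁ + m·b₆`. [folklore] -/
theorem sum_roots_aeval_Ψ₂Sq_eq (W : WeierstrassCurve ℚ) {h : ℚ[X]} (hmon : h.Monic) {m : ℕ}
    (hdegm : h.natDegree = m) (hm2 : 2 ≤ m) {E₁ E₂ E₃ : ℚ} (hE₁ : h.coeff (m - 1) = -E₁)
    (hE₂ : h.coeff (m - 2) = E₂) (hE₃ : (3 ≤ m ∧ h.coeff (m - 3) = -E₃) ∨ (m = 2 ∧ E₃ = 0)) :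
    (((h.map (algebraMap ℚ (AlgebraicClosure ℚ))).roots).map (fun α ↦ aeval α W.Ψ₂Sq)).sum =
      algebraMap ℚ (AlgebraicClosure ℚ)
        (4 * (E₁ ^ 3 - 3 * E₁ * E₂ + 3 * E₃) + W.b₂ * (E₁ ^ 2 - 2 * E₂) + 2 * W.b₄ * E₁ + m * W.b₆) := by
  set s := (h.map (algebraMap ℚ (AlgebraicClosure ℚ))).roots with hs
  obtain ⟨hcard, he1⟩ := roots_esymm_eq_coeff hmon hdegm (k := 1) (by omega)
  obtain ⟨-, he2⟩ := roots_esymm_eq_coeff hmon hdegm (k := 2) hm2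
  rw [← hs] at hcard he1 he2
  rw [hE₁, pow_one, map_neg, neg_one_mul, neg_neg] at he1
  rw [hE₂, neg_one_sq, one_mul] at he2
  have he3 : s.esymm 3 = algebraMap ℚ (AlgebraicClosure ℚ) E₃ := by
    rcases hE₃ with ⟨hm3, h3⟩ | ⟨hm, h0⟩
    · obtain ⟨-, he3⟩ := roots_esymm_eq_coeff hmon hdegm (k := 3) hm3
      rw [← hs, h3, map_neg] at he3
      rw [he3]; ring
    · rw [h0, map_zero]
      exact esymm_eq_zero_of_card_lt s (by rw [hcard, hm]; norm_num)
  have hfun : (fun α ↦ aeval α W.Ψ₂Sq) = fun α : AlgebraicClosure ℚ ↦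
      4 * α ^ 3 + algebraMap ℚ (AlgebraicClosure ℚ) W.b₂ * α ^ 2 +
        (2 * algebraMap ℚ (AlgebraicClosure ℚ) W.b₄) * α + algebraMap ℚ (AlgebraicClosure ℚ) W.b₆ := by
    funext α; exact aeval_Ψ₂Sq_eq W α
  rw [hfun, sum_map_cubic_eq, sum_map_pow_three_eq, sum_map_pow_two_eq, sum_map_pow_one_eq, he1, he2,
    he3, hcard]
  simp only [map_add, map_mul, map_sub, map_pow, map_ofNat, map_natCast]

/-! ## §4 The certificates -/

/-- A non-empty sum of complex numbers with negative real parts has negative real part. [folklore] -/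
theorem re_multiset_sum_neg (t : Multiset ℂ) (h : ∀ z ∈ t, z.re < 0) (ht : t ≠ 0) : t.sum.re < 0 := by
  induction t using Multiset.induction_on with
  | empty => exact absurd rfl ht
  | cons a u ih =>
    rw [Multiset.sum_cons, Complex.add_re]
    have ha : a.re < 0 := h a (Multiset.mem_cons_self a u)
    by_cases hu : u = 0
    · rw [hu, Multiset.sum_zero, Complex.zero_re, add_zero]; exact ha
    · have hu' := ih (fun z hz ↦ h z (Multiset.mem_cons_of_mem hz)) hu
      linarith

/-- A non-empty sum of complex numbers with positive real parts has positive real part. [folklore] -/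
theorem re_multiset_sum_pos (t : Multiset ℂ) (h : ∀ z ∈ t, 0 < z.re) (ht : t ≠ 0) : 0 < t.sum.re := by
  induction t using Multiset.induction_on with
  | empty => exact absurd rfl ht
  | cons a u ih =>
    rw [Multiset.sum_cons, Complex.add_re]
    have ha : 0 < a.re := h a (Multiset.mem_cons_self a u)
    by_cases hu : u = 0
    · rw [hu, Multiset.sum_zero, Complex.zero_re, add_zero]; exact ha
    · have hu' := ih (fun z hz ↦ h z (Multiset.mem_cons_of_mem hz)) hu
      linarith

section Cert

variable {W : WeierstrassCurve ℚ} [W.IsElliptic] {p : ℕ} [Fact p.Prime]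

/-- The embedding of a complex conjugation sends `algebraMap ℚ ℚ̄ T` to `T`. [folklore] -/
theorem re_apply_algebraMap {ι : AlgebraicClosure ℚ →+* ℂ}
    (hιφ : ι.comp (algebraMap ℚ (AlgebraicClosure ℚ)) = Complex.ofRealHom.comp (Rat.castHom ℝ))
    (T : ℚ) : (ι (algebraMap ℚ (AlgebraicClosure ℚ) T)).re = T := by
  have e := congrArg (fun f : ℚ →+* ℂ ↦ f T) hιφ
  simp only [RingHom.coe_comp, Function.comp_apply] at e
  rw [e]
  simp

omit [W.IsElliptic] in
/-- The real parts of `ι(Ψ₂Sq(α))` over the roots `α` of `h` sum to `T(h)`: the common value of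
`ι` on the (rational) trace. [folklore] -/
theorem re_apply_sum_roots_eq {h : ℚ[X]} (hmon : h.Monic) {m : ℕ} (hdegm : h.natDegree = m)
    (hm2 : 2 ≤ m) {E₁ E₂ E₃ : ℚ} (hE₁ : h.coeff (m - 1) = -E₁) (hE₂ : h.coeff (m - 2) = E₂)
    (hE₃ : (3 ≤ m ∧ h.coeff (m - 3) = -E₃) ∨ (m = 2 ∧ E₃ = 0))
    {ι : AlgebraicClosure ℚ →+* ℂ}
    (hιφ : ι.comp (algebraMap ℚ (AlgebraicClosure ℚ)) = Complex.ofRealHom.comp (Rat.castHom ℝ)) :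
    ((((h.map (algebraMap ℚ (AlgebraicClosure ℚ))).roots).map (fun α ↦ ι (aeval α W.Ψ₂Sq))).sum).re =
      ((4 * (E₁ ^ 3 - 3 * E₁ * E₂ + 3 * E₃) + W.b₂ * (E₁ ^ 2 - 2 * E₂) + 2 * W.b₄ * E₁ + m * W.b₆ : ℚ) : ℝ) := by
  have e := congrArg (fun z ↦ (ι z).re) (sum_roots_aeval_Ψ₂Sq_eq W hmon hdegm hm2 hE₁ hE₂ hE₃)
  rw [map_multiset_sum, Multiset.map_map, Function.comp_def] at e
  rw [e]
  exact re_apply_algebraMap hιφ _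

/-- **TRACE CERTIFICATE (even).** Let `Φ ≤ E[p]` (`p` odd, `2m + 1 = p`) be a rational `p`-line
every non-zero point of which has abscissa a root of `h`, where `W.preΨ' p = h · q` and `h` is MONIC
of degree `m` with `coeff_{m−1} = −E₁`, `coeff_{m−2} = E₂`, `coeff_{m−3} = −E₃` (`m ≥ 3`) resp.
`E₃ = 0` (`m = 2`). If `T(h) = 4(E₁³ − 3E₁E₂ + 3E₃) + b₂(E₁² − 2E₂) + 2b₄E₁ + m·b₆ > 0` then `Φ` is
EVEN (complex conjugation fixes it pointwise). [cite: GreenbergVatsal2000, Thm. 1.3 ("even")]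
[cite: SilvermanAEC2009, III.2.3] -/
theorem lineEven_of_traceCert_pos (hp2 : p ≠ 2) {h q : ℚ[X]} {m : ℕ} (hm : 2 * m + 1 = p)
    (hmon : h.Monic) (hdegm : h.natDegree = m) (hdiv : W.preΨ' p = h * q)
    {Φ : AddSubgroup (geomTorsion W (p : ℤ))} (hΦ : IsRationalLine W p Φ)
    (habs : ∀ Q ∈ Φ, Q ≠ 0 → ∃ (x y : AlgebraicClosure ℚ)
      (hxy : (W.baseChange (AlgebraicClosure ℚ)).toAffine.Nonsingular x y),
      (Q : W.geomPoints) = Affine.Point.some x y hxy ∧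
        (h.map (algebraMap ℚ (AlgebraicClosure ℚ))).eval x = 0)
    {E₁ E₂ E₃ : ℚ} (hE₁ : h.coeff (m - 1) = -E₁) (hE₂ : h.coeff (m - 2) = E₂)
    (hE₃ : (3 ≤ m ∧ h.coeff (m - 3) = -E₃) ∨ (m = 2 ∧ E₃ = 0))
    (hT : 0 < 4 * (E₁ ^ 3 - 3 * E₁ * E₂ + 3 * E₃) + W.b₂ * (E₁ ^ 2 - 2 * E₂) + 2 * W.b₄ * E₁ + m * W.b₆) :
    LineEven W p Φ := by
  have hp : p.Prime := Fact.out
  rcases lineEven_or_lineOdd hΦ with he | ho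
  · exact he
  exfalso
  have hm2 : 2 ≤ m := by
    by_contra hlt
    have : p < 5 := by omega
    interval_cases p <;> first | exact absurd rfl hp2 | exact absurd hp (by decide) | omega
  obtain ⟨c, hc⟩ := exists_isComplexConjugation (Rat.castHom ℝ)
  obtain ⟨ι, hιφ, hι⟩ := isComplexConjugation_iff.mp hc
  have hh0 : h.map (algebraMap ℚ (AlgebraicClosure ℚ)) ≠ 0 :=
    Polynomial.map_ne_zero hmon.ne_zero
  set s := (h.map (algebraMap ℚ (AlgebraicClosure ℚ))).roots with hs
  have hneg : ∀ z ∈ s.map (fun α ↦ ι (aeval α W.Ψ₂Sq)), z.re < 0 := by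
    intro z hz
    obtain ⟨α, hα, rfl⟩ := Multiset.mem_map.mp hz
    have hα' : (h.map (algebraMap ℚ (AlgebraicClosure ℚ))).eval α = 0 := (mem_roots hh0).mp hα
    obtain ⟨Q, hQΦ, hQ0, y, hxy, hQ⟩ :=
      exists_mem_abscissa_of_eval_eq_zero hp2 hm hdegm.le hdiv hΦ habs hα'
    exact (KernelDisc.re_neg_of_lineOdd hΦ hp2 hQΦ hQ0 hQ hc hι ho).1
  have hs0 : s.map (fun α ↦ ι (aeval α W.Ψ₂Sq)) ≠ 0 := by
    intro h0
    have hc0 := congrArg Multiset.card h0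
    rw [Multiset.card_map, Multiset.card_zero, hs, (roots_esymm_eq_coeff hmon hdegm (k := 0) (by omega)).1] at hc0
    omega
  have hlt := re_multiset_sum_neg _ hneg hs0
  rw [hs, re_apply_sum_roots_eq hmon hdegm hm2 hE₁ hE₂ hE₃ hιφ] at hlt
  have hT' : (0 : ℝ) < ((4 * (E₁ ^ 3 - 3 * E₁ * E₂ + 3 * E₃) + W.b₂ * (E₁ ^ 2 - 2 * E₂) + 2 * W.b₄ * E₁ +
      m * W.b₆ : ℚ) : ℝ) := by exact_mod_cast hT
  linarith

/-- **TRACE CERTIFICATE (odd).** Same data; if `T(h) < 0` then `Φ` is ODD.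
[cite: GreenbergVatsal2000, Thm. 1.3 ("odd")] [cite: SilvermanAEC2009, III.2.3] -/
theorem lineOdd_of_traceCert_neg (hp2 : p ≠ 2) {h q : ℚ[X]} {m : ℕ} (hm : 2 * m + 1 = p)
    (hmon : h.Monic) (hdegm : h.natDegree = m) (hdiv : W.preΨ' p = h * q)
    {Φ : AddSubgroup (geomTorsion W (p : ℤ))} (hΦ : IsRationalLine W p Φ)
    (habs : ∀ Q ∈ Φ, Q ≠ 0 → ∃ (x y : AlgebraicClosure ℚ)
      (hxy : (W.baseChange (AlgebraicClosure ℚ)).toAffine.Nonsingular x y),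
      (Q : W.geomPoints) = Affine.Point.some x y hxy ∧
        (h.map (algebraMap ℚ (AlgebraicClosure ℚ))).eval x = 0)
    {E₁ E₂ E₃ : ℚ} (hE₁ : h.coeff (m - 1) = -E₁) (hE₂ : h.coeff (m - 2) = E₂)
    (hE₃ : (3 ≤ m ∧ h.coeff (m - 3) = -E₃) ∨ (m = 2 ∧ E₃ = 0))
    (hT : 4 * (E₁ ^ 3 - 3 * E₁ * E₂ + 3 * E₃) + W.b₂ * (E₁ ^ 2 - 2 * E₂) + 2 * W.b₄ * E₁ + m * W.b₆ < 0) :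
    LineOdd W p Φ := by
  have hp : p.Prime := Fact.out
  rcases lineEven_or_lineOdd hΦ with he | ho
  swap
  · exact ho
  exfalso
  have hm2 : 2 ≤ m := by
    by_contra hlt
    have : p < 5 := by omega
    interval_cases p <;> first | exact absurd rfl hp2 | exact absurd hp (by decide) | omega
  obtain ⟨c, hc⟩ := exists_isComplexConjugation (Rat.castHom ℝ)
  obtain ⟨ι, hιφ, hι⟩ := isComplexConjugation_iff.mp hc
  have hh0 : h.map (algebraMap ℚ (AlgebraicClosure ℚ)) ≠ 0 :=
    Polynomial.map_ne_zero hmon.ne_zero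
  set s := (h.map (algebraMap ℚ (AlgebraicClosure ℚ))).roots with hs
  have hpos : ∀ z ∈ s.map (fun α ↦ ι (aeval α W.Ψ₂Sq)), 0 < z.re := by
    intro z hz
    obtain ⟨α, hα, rfl⟩ := Multiset.mem_map.mp hz
    have hα' : (h.map (algebraMap ℚ (AlgebraicClosure ℚ))).eval α = 0 := (mem_roots hh0).mp hα
    obtain ⟨Q, hQΦ, hQ0, y, hxy, hQ⟩ :=
      exists_mem_abscissa_of_eval_eq_zero hp2 hm hdegm.le hdiv hΦ habs hα'
    exact (KernelDisc.re_pos_of_lineEven hΦ hp2 hQΦ hQ0 hQ hc hι he).1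
  have hs0 : s.map (fun α ↦ ι (aeval α W.Ψ₂Sq)) ≠ 0 := by
    intro h0
    have hc0 := congrArg Multiset.card h0
    rw [Multiset.card_map, Multiset.card_zero, hs, (roots_esymm_eq_coeff hmon hdegm (k := 0) (by omega)).1] at hc0
    omega
  have hlt := re_multiset_sum_pos _ hpos hs0
  rw [hs, re_apply_sum_roots_eq hmon hdegm hm2 hE₁ hE₂ hE₃ hιφ] at hlt
  have hT' : ((4 * (E₁ ^ 3 - 3 * E₁ * E₂ + 3 * E₃) + W.b₂ * (E₁ ^ 2 - 2 * E₂) + 2 * W.b₄ * E₁ +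
      m * W.b₆ : ℚ) : ℝ) < 0 := by exact_mod_cast hT
  linarith

end Cert

end Summit.BirchSwinnertonDyer.Rank1Residual.Additive.KernelPolyLine

end
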